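import Summits.QuantumFields.YangMills.Theorems.UnitScaleTiltProp7OneFormAgmonLetters
import Summits.QuantumFields.YangMills.Theorems.UnitScaleTiltProp7QkCutoffCommutator
import HarnessLib

/-!
# Route `UnitScaleTilt`, crux K1 «MinimiserStabilityRegPr» (stmt-QuantumFields-19200), EX face S45 — (L3′b)-VALUE, ONE-FORM STOREY, pen (P-1FA) «ONE-FORM AGMON», FILE A2b:
# **THE AVERAGING PENALTY `a·Q_k†Q_k` UNDER RECIPROCAL WEIGHTS** — the RELATIVE commutator `[Q_k(U₀), w]` of the averaging operator of record at a printed-regular background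
# (the multiplicative twin of routeR-w4 ✓`Prop7QkCutoffCommutator.sum_normSq_entries_QTwS_cutoff_comm_le`) and the (Q) piece of A3's `hVconj`

Cell `ym3-torus` (HUMAN RULING D-0037; rung R3 = SU(2) YM₃ on T³ — NOT d = 4, NOT infinite volume, NOT a mass gap, NOT Clay).  Width seat `ym3-torus-px21` (gen 14);
★p1 g26 CHAIR WORD №6 SPLIT: A1 ✓`Prop7OneFormGarding` (chair), A2 = px21 (THIS series), A3 ✓∕⧗`Prop7OneFormAgmon` (chair; its hypothesis `hVconj` is the export of this series).
THEOREMS ONLY (0 `def`, 0 `sorry`); `--supports stmt-QuantumFields-19200 --as helper`; count-neutral.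

WHY.  In `V := Δ_a − D†D` the penalty `a·Q_k†Q_k` is the only piece touching `RegPr` (the averaging of record `QTwS U₀` reads parallel transports of the background).  Conjugating by the bond
multiplier `w(b₋)·`, per coarse bond `ĉ` one splits the weighted field at a reference site `x_r(ĉ)`: `QTwS(w·X) ĉ = w(x_r ĉ)·(QTwS X ĉ + E ĉ)`, `E ĉ = QTwS((w∕w(x_r ĉ) − 1)·X) ĉ` (ℂ-linearity), and
TWO-BLOCK LOCALITY ✓`QTwS_congr_of_agree` replaces the oscillation field by its truncation to the read set of `ĉ`, where `|w∕w(x_r ĉ) − 1| ≤ ρ_Q`; FILE 1b ✓`sum_normSq_entries_QTwS_le` and the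
read-set multiplicity ✓`sum_sum_read_le` give `Σ_ĉ|E ĉ|² ≤ 216ρ_Q²(ℓ²∕ℓ^d)Σ_b|X b|²`.  In `Q_k = η•toL2B∘QTwS∘toL2⁻¹` letters the reciprocal block weights pair to the identity and A2a §0 gives
the (Q) piece with `κ² = 216ρ_Q²(cB∕(c₀ℓ³))` (`η²ℓ² = 1`): K-FREE at the pin `cB = c₀ℓ³`.
WHAT IS PROVED (ns `Summit.QuantumFields.YangMills.Theorems.Prop7OneFormAgmonAveraging`; member `F`, `n ≤ K`, weights `c₀ cB`).
* §5 `smul_field_eq_ref`, ★ `QTwS_smul_eq_ref` (the split, ANY `U₀`), ★★ `sum_normSq_entries_QTwS_relComm_le` — `RegPr F n K ε₀ U₀`, `10¹⁰L⁶ε₀ ≤ 1`, `10¹²L³ε₀ ≤ 1`, reference sites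
  `x_r : PBond (F.P n) 0 → Site (F.P K) 0` with `|w(b₋)∕w(x_r ĉ) − 1| ≤ ρ_Q` on the read set of `ĉ`: `Σ_ĉ Σ_{jk}|(QTwS U₀ ((w(b₋)∕w(x_r ĉ) − 1)·X) ĉ)_{jk}|² ≤ 216·ρ_Q²·(ℓ²∕ℓ^d)·Σ_b Σ_{jk}|X(b)_{jk}|²`.
* §6 `inner_toL2B_smul_smul_inv`, `Qk_toL2_smul_eq_ref`, ★★ `abs_re_inner_Qk_conj_sub_le` — with both read-set ratios `≤ ρ_Q`:
  `|re⟪Q_k(toL2(w(b₋)·X)), Q_k(toL2(w(b₋)⁻¹·X))⟫ − ‖Q_k(toL2 X)‖²| ≤ 2√κ²·‖Q_k(toL2 X)‖·‖toL2 X‖ + κ²·‖toL2 X‖²`, `κ² = 216ρ_Q²(cB∕(c₀ℓ³))`.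
HYP-SAT (★★OWNER RULING №42): `RegPr` + routeR-w4's two windows exactly as ✓`sum_normSq_entries_QTwS_cutoff_comm_le` (inhabited on the literal T³ families for `ε₀ ≤ αcap L`); the read-set
ratio rows are inhabited by any `e^{φ}` with per-bond slope `μη` (`ρ_Q ≤ e^{7μ} − 1`, read set ⊂ two adjacent blocks); nothing eventual; no hypothesis restates a conclusion.
HONEST SCOPE.  Letters; nothing of (P-1FA)'s export, the ten EX rows, `hT`, EX or the crux is proved here; the Yang–Mills mass gap is NOT proved.

References: T. Bałaban, CMP **99** (1985) 389–434 [Balaban1985BackgroundPropagators] ((3.3) p.391, (3.11) p.392, (3.13)–(3.16) p.393, (3.21)–(3.26) pp.394–395, Thm 3.1 (3.46) p.398,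
(3.49) p.399, Thm 3.12 p.422); CMP **102** (1985) 277–309 [Balaban1985Variational] ((44)–(45) p.285, (134)–(136) p.298); CMP **95** (1984) 17–40 [Balaban1984PropagatorsI] ((1.18) p.20);
S. Agmon, *Lectures on exponential decay of solutions of second-order elliptic equations* (Princeton 1982) Ch. 1 [Agmon1982].
-/

set_option autoImplicit false

noncomputable section

open scoped BigOperators Matrix.Norms.L2Operator InnerProductSpace ComplexConjugate

namespace Summit.QuantumFields.YangMills.Theorems.Prop7OneFormAgmonAveraging

open Literature.MathematicalPhysics.QuantumFieldTheory.Balaban1983to89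
open Literature.MathematicalPhysics.QuantumFieldTheory.Balaban1983to89.T3ContinuumYM3Torus
open T3SectALandauChart (eta eta_pos bgUnits formComp)
open B9TorusCalculus (torusT)
open B9Eq310Hermitian (deltaPrimeOp)
open B11Eq135Weitzenbock (curvOp)
open B11Eq103H1Complex (SiteL2K BondL2K)
open B9Eq39Adjoint (R)
open B5Eq118OneStroke (iterBlockOf)
open Summit.QuantumFields.YangMills.Theorems.Prop7SectET3Transport (periodsT3 siteEquiv bondEquiv)
open Summit.QuantumFields.YangMills.Theorems.Prop7SectET3HilbertLetters (W₂ frobEquiv toL2 toL2S DL2 DstarL2 covLapSite adjoint_DL2 inner_toL2 inner_covLapSite)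
open Summit.QuantumFields.YangMills.Theorems.Prop7SectET3WilsonHessian (DeltaEta DeltaEtaSlot)
open Summit.QuantumFields.YangMills.Theorems.Prop7SectET3GaugeProjector (RS RS_eq_projR)
open Summit.QuantumFields.YangMills.Theorems.Prop7SectET3CurvedPropagators (laplaceA Qk)
open Summit.QuantumFields.YangMills.Theorems.Prop7SectET3DeltaEtaExplicit (sum_pbond_eq)
open Summit.QuantumFields.YangMills.Theorems.Prop7RieszTauFrobNorm (norm_sq_frobEquiv_symm norm_le_norm_frobEquiv_symm norm_frobEquiv_symm_le)
open Summit.QuantumFields.YangMills.Theorems.Prop7LaplaceAFlatLetters (norm_sq_toL2 norm_sq_toL2S)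
open Summit.QuantumFields.YangMills.Theorems.Prop7BlockBumpExtension (sum_comp_iterBlockOf)
open Summit.QuantumFields.YangMills.Theorems.Prop7BlockDistanceWeights (sum_exp_neg_mul_tdist_coarse_le tdist_coarse_comm eta_mul_pow_eq_one)
open Summit.QuantumFields.YangMills.Theorems.Prop7MassivePropagatorAgmonLetters (inner_toL2S_smul_left inner_toL2_smul_left inner_toL2S_smul_smul_inv
  inner_toL2_smul_smul_inv DL2_smul_eq_smul_add_defect normSq_gradDefect_le)
open Summit.QuantumFields.YangMills.Theorems.Prop7OneFormKatoForm (covLapSite_toL2S_formComp_eq)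
open Summit.QuantumFields.YangMills.Theorems.Prop7OneFormGarding (sum_inner_toL2S_formComp)
open T3PrintedRegularMinimiser (RegPr)
open T3PrintedRegularOrbits (sites_eq)
open T3LevelShift (bondShift)
open Summit.QuantumFields.YangMills.Theorems.Prop7SymAvgTwSym (QTwS)
open Summit.QuantumFields.YangMills.Theorems.Prop7SectET3HilbertLetters (toL2B inner_toL2B)
open Summit.QuantumFields.YangMills.Theorems.Prop7TransverseRowOfTubeRowRegPr (Qk_toL2)
open Summit.QuantumFields.YangMills.Theorems.Prop7EngOfTrueAvgBudget (norm_toL2B_sq)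
open Summit.QuantumFields.YangMills.Theorems.Prop7CmapTwSReadSet (QTwS_congr_of_agree)
open Summit.QuantumFields.YangMills.Theorems.Prop7QTwSEllTwoBound (sum_normSq_entries_QTwS_le)
open Summit.QuantumFields.YangMills.Theorems.Prop7QkCutoffCommutator (sum_sum_read_le)
open Summit.QuantumFields.YangMills.Theorems.Prop7OneFormAgmonLetters (abs_re_inner_add_add_sub_sq_le)

/-! ## §5 The relative commutator of the averaging operator of record with the weight -/

section Averaging

variable (F : T3Family) (n K : ℕ) (h : n ≤ K)

/-- **THE WEIGHTED FIELD SPLIT RELATIVE TO A REFERENCE SITE**: `w(b₋)·X = w(x_r)·(X + (w(b₋)∕w(x_r) − 1)·X)` as bond fields (`w(x_r) ≠ 0`). [folklore] -/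
theorem smul_field_eq_ref (w : Site (F.P K) 0 → ℝ) (xr : Site (F.P K) 0) (hxr : w xr ≠ 0) (X : PBond (F.P K) 0 → Matrix (Fin 2) (Fin 2) ℂ) :
    (fun b : PBond (F.P K) 0 => w b.src • X b) = ((w xr : ℝ) : ℂ) • (X + fun b : PBond (F.P K) 0 => (((w b.src / w xr - 1 : ℝ)) : ℂ) • X b) := by
  funext b
  simp only [Pi.smul_apply, Pi.add_apply, smul_add, smul_smul]
  rw [← Complex.coe_smul, ← add_smul]
  congr 1
  have hx : ((w xr : ℝ) : ℂ) ≠ 0 := by exact_mod_cast hxr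
  push_cast
  field_simp
  ring

/-- ★ **THE AVERAGING OF A WEIGHTED FIELD, SPLIT AT A REFERENCE SITE PER COARSE BOND** (ℂ-linearity of `QTwS`): for reference sites `x_r(ĉ)`,
`QTwS U₀ (w(b₋)·X) ĉ = w(x_r ĉ)·(QTwS U₀ X ĉ + QTwS U₀ ((w(b₋)∕w(x_r ĉ) − 1)·X) ĉ)` — the second summand is the RELATIVE commutator entry. [cite: Balaban1985BackgroundPropagators, (3.14) p.393] -/
theorem QTwS_smul_eq_ref (U₀ : GaugeField (F.P K) 0 (Matrix.specialUnitaryGroup (Fin 2) ℂ)) (w : Site (F.P K) 0 → ℝ)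
    (xr : PBond (F.P n) 0 → Site (F.P K) 0) (hxr : ∀ c, w (xr c) ≠ 0) (X : PBond (F.P K) 0 → Matrix (Fin 2) (Fin 2) ℂ) (c : PBond (F.P n) 0) :
    QTwS F n K h U₀ (fun b : PBond (F.P K) 0 => w b.src • X b) c
      = ((w (xr c) : ℝ) : ℂ) • (QTwS F n K h U₀ X c + QTwS F n K h U₀ (fun b : PBond (F.P K) 0 => (((w b.src / w (xr c) - 1 : ℝ)) : ℂ) • X b) c) := by
  rw [smul_field_eq_ref F K w (xr c) (hxr c) X, map_smul, map_add, Pi.smul_apply, Pi.add_apply]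

set_option maxHeartbeats 400000 in
-- hb: two-block locality + FILE 1b under a double sum (the budget of routeR-w4 ✓`sum_normSq_entries_QTwS_cutoff_comm_le`, same road).
/-- ★★ **THE RELATIVE COMMUTATOR OF THE AVERAGING OPERATOR OF RECORD, CARRIER LETTERS** (the multiplicative twin of routeR-w4 ✓`sum_normSq_entries_QTwS_cutoff_comm_le`):
`RegPr F n K ε₀ U₀`, `10¹⁰L⁶ε₀ ≤ 1`, `10¹²L³ε₀ ≤ 1`; a real weight `w` and reference sites `x_r(ĉ)` with the READ-SET RELATIVE OSCILLATION `|w(b₋)∕w(x_r ĉ) − 1| ≤ ρ_Q` for every fine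
bond `b` whose source block is `ĉ₋` or `ĉ₊`.  Then `Σ_ĉ Σ_{jk} |(QTwS U₀ ((w(b₋)∕w(x_r ĉ) − 1)·X) ĉ)_{jk}|² ≤ 216·ρ_Q²·(ℓ²∕ℓ^d)·Σ_b Σ_{jk} |X(b)_{jk}|²` (`216 = 36·2d`):
two-block locality ✓`QTwS_congr_of_agree` truncates the oscillation field to the read set; FILE 1b ✓`sum_normSq_entries_QTwS_le`; read-set multiplicity ✓`sum_sum_read_le`.
[cite: Balaban1985BackgroundPropagators, (3.13)–(3.16) p.393, (3.100) pp.413–414; Balaban1984PropagatorsI, (1.18) p.20] -/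
theorem sum_normSq_entries_QTwS_relComm_le {ε₀ : ℝ} (hε₀ : 0 < ε₀) (hε : 10 ^ 10 * (F.L : ℝ) ^ 6 * ε₀ ≤ 1) (hε12 : 10 ^ 12 * (F.L : ℝ) ^ 3 * ε₀ ≤ 1)
    (W : GaugeField (F.P K) 0 (Matrix.specialUnitaryGroup (Fin 2) ℂ)) (hreg : RegPr F n K ε₀ W)
    (w : Site (F.P K) 0 → ℝ) (xr : PBond (F.P n) 0 → Site (F.P K) 0) {ρQ : ℝ}
    (hρQ : ∀ (c : PBond (F.P n) 0) (b : PBond (F.P K) 0),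
      (iterBlockOf (K - n) b.src = (bondShift (sites_eq F n K h) c).src ∨ iterBlockOf (K - n) b.src = (bondShift (sites_eq F n K h) c).tgt) →
      |w b.src / w (xr c) - 1| ≤ ρQ)
    (X : PBond (F.P K) 0 → Matrix (Fin 2) (Fin 2) ℂ) :
    ∑ bc : PBond (F.P n) 0, ∑ j, ∑ k, ‖(QTwS F n K h W (fun b : PBond (F.P K) 0 => (((w b.src / w (xr bc) - 1 : ℝ)) : ℂ) • X b) bc) j k‖ ^ 2
      ≤ 216 * ρQ ^ 2 * (((F.L : ℝ) ^ (K - n)) ^ 2 / ((F.L : ℝ) ^ (K - n)) ^ (F.P K).d) * ∑ b : PBond (F.P K) 0, ∑ j, ∑ k, ‖X b j k‖ ^ 2 := by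
  classical
  have hd : (F.P K).d = 3 := T3Family.P_d F K
  have hL3 : (3 : ℝ) ≤ F.L := by
    have h3 : 3 ≤ F.L := by obtain ⟨a, ha⟩ := F.hL.1; have := F.hL.2; omega
    exact_mod_cast h3
  have hL0 : (0 : ℝ) < F.L := by linarith
  -- a window letter for the locality lemma
  set e : ℝ := (10 ^ 9 * (F.L : ℝ) ^ 2)⁻¹ with he_def
  have he : 0 < e := by rw [he_def]; positivity
  have hWe : 10 ^ 9 * (F.L : ℝ) ^ 2 * e ≤ 1 := by rw [he_def, mul_inv_cancel₀ (by positivity)]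
  set ρ : ℝ := ((F.L : ℝ) ^ (K - n)) ^ 2 / ((F.L : ℝ) ^ (K - n)) ^ (F.P K).d with hρ
  have hρ0 : 0 ≤ ρ := by positivity
  -- the truncated relative oscillation field of `bc`
  set φ : PBond (F.P n) 0 → PBond (F.P K) 0 → ℝ := fun bc b =>
    if (iterBlockOf (K - n) b.src = (bondShift (sites_eq F n K h) bc).src ∨ iterBlockOf (K - n) b.src = (bondShift (sites_eq F n K h) bc).tgt)
    then w b.src / w (xr bc) - 1 else 0 with hφ
  have hφle : ∀ bc b, (φ bc b) ^ 2 ≤ if (iterBlockOf (K - n) b.src = (bondShift (sites_eq F n K h) bc).src ∨ iterBlockOf (K - n) b.src = (bondShift (sites_eq F n K h) bc).tgt)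
      then ρQ ^ 2 else 0 := by
    intro bc b
    by_cases hb : (iterBlockOf (K - n) b.src = (bondShift (sites_eq F n K h) bc).src ∨ iterBlockOf (K - n) b.src = (bondShift (sites_eq F n K h) bc).tgt)
    · simp only [hφ, if_pos hb]
      rw [← sq_abs]; exact pow_le_pow_left₀ (abs_nonneg _) (hρQ bc b hb) 2
    · simp only [hφ, if_neg hb]; simp
  -- per `bc`: locality
  have hloc : ∀ bc : PBond (F.P n) 0,
      QTwS F n K h W (fun b : PBond (F.P K) 0 => (((w b.src / w (xr bc) - 1 : ℝ)) : ℂ) • X b) bc = QTwS F n K h W (fun b => ((φ bc b : ℝ) : ℂ) • X b) bc := by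
    intro bc
    refine QTwS_congr_of_agree F n K h hε₀ he hWe hε12 W hreg bc fun b hbs _ => ?_
    simp only [hφ, if_pos hbs]
  -- per `bc`: FILE 1b on the truncated field
  have hper : ∀ bc : PBond (F.P n) 0,
      ∑ j, ∑ k, ‖(QTwS F n K h W (fun b : PBond (F.P K) 0 => (((w b.src / w (xr bc) - 1 : ℝ)) : ℂ) • X b) bc) j k‖ ^ 2
        ≤ 36 * ρ * ∑ b : PBond (F.P K) 0, (φ bc b) ^ 2 * ∑ j, ∑ k, ‖X b j k‖ ^ 2 := by
    intro bc
    rw [hloc bc]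
    have hfull := sum_normSq_entries_QTwS_le F n K h hε₀ hε hε12 W hreg (fun b => ((φ bc b : ℝ) : ℂ) • X b)
    rw [← hρ] at hfull
    have hone : ∑ j, ∑ k, ‖(QTwS F n K h W (fun b => ((φ bc b : ℝ) : ℂ) • X b) bc) j k‖ ^ 2
        ≤ ∑ bc' : PBond (F.P n) 0, ∑ j, ∑ k, ‖(QTwS F n K h W (fun b => ((φ bc b : ℝ) : ℂ) • X b) bc') j k‖ ^ 2 :=
      Finset.single_le_sum (f := fun bc' => ∑ j, ∑ k, ‖(QTwS F n K h W (fun b => ((φ bc b : ℝ) : ℂ) • X b) bc') j k‖ ^ 2)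
        (fun bc' _ => by positivity) (Finset.mem_univ bc)
    have hsm : ∀ b : PBond (F.P K) 0, ∑ j, ∑ k, ‖((((φ bc b : ℝ) : ℂ) • X b) : Matrix (Fin 2) (Fin 2) ℂ) j k‖ ^ 2 = (φ bc b) ^ 2 * ∑ j, ∑ k, ‖X b j k‖ ^ 2 := by
      intro b
      rw [Finset.mul_sum]; refine Finset.sum_congr rfl fun j _ => ?_; rw [Finset.mul_sum]; refine Finset.sum_congr rfl fun k _ => ?_
      rw [Matrix.smul_apply, smul_eq_mul, norm_mul, Complex.norm_real, Real.norm_eq_abs, mul_pow, sq_abs]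
    simp only [hsm] at hfull
    exact hone.trans hfull
  -- assemble
  have hN : ∀ b : PBond (F.P K) 0, 0 ≤ ∑ j, ∑ k, ‖X b j k‖ ^ 2 := fun b => by positivity
  calc ∑ bc : PBond (F.P n) 0, ∑ j, ∑ k, ‖(QTwS F n K h W (fun b : PBond (F.P K) 0 => (((w b.src / w (xr bc) - 1 : ℝ)) : ℂ) • X b) bc) j k‖ ^ 2
      ≤ ∑ bc : PBond (F.P n) 0, 36 * ρ * ∑ b : PBond (F.P K) 0, (φ bc b) ^ 2 * ∑ j, ∑ k, ‖X b j k‖ ^ 2 := Finset.sum_le_sum fun bc _ => hper bc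
    _ = 36 * ρ * ∑ bc : PBond (F.P n) 0, ∑ b : PBond (F.P K) 0, (φ bc b) ^ 2 * ∑ j, ∑ k, ‖X b j k‖ ^ 2 := by rw [Finset.mul_sum]
    _ ≤ 36 * ρ * ∑ bc : PBond (F.P n) 0, ∑ b : PBond (F.P K) 0,
          (if (iterBlockOf (K - n) b.src = (bondShift (sites_eq F n K h) bc).src ∨ iterBlockOf (K - n) b.src = (bondShift (sites_eq F n K h) bc).tgt)
            then ρQ ^ 2 * ∑ j, ∑ k, ‖X b j k‖ ^ 2 else 0) := by
        refine mul_le_mul_of_nonneg_left (Finset.sum_le_sum fun bc _ => Finset.sum_le_sum fun b _ => ?_) (by positivity)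
        have h1 := mul_le_mul_of_nonneg_right (hφle bc b) (hN b)
        by_cases hb : (iterBlockOf (K - n) b.src = (bondShift (sites_eq F n K h) bc).src ∨ iterBlockOf (K - n) b.src = (bondShift (sites_eq F n K h) bc).tgt)
        · simp only [if_pos hb] at h1 ⊢; exact h1
        · simp only [if_neg hb, zero_mul] at h1 ⊢; exact h1
    _ = 36 * ρ * ∑ c' : PBond (F.P K) (K - n), ∑ b : PBond (F.P K) 0,
          (if (iterBlockOf (K - n) b.src = (c').src ∨ iterBlockOf (K - n) b.src = (c').tgt) then ρQ ^ 2 * ∑ j, ∑ k, ‖X b j k‖ ^ 2 else 0) := by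
        congr 1
        exact Fintype.sum_equiv (bondShift (sites_eq F n K h)) _
          (fun c' : PBond (F.P K) (K - n) => ∑ b : PBond (F.P K) 0,
            (if (iterBlockOf (K - n) b.src = (c').src ∨ iterBlockOf (K - n) b.src = (c').tgt) then ρQ ^ 2 * ∑ j, ∑ k, ‖X b j k‖ ^ 2 else 0)) (fun _ => rfl)
    _ ≤ 36 * ρ * (2 * ((F.P K).d : ℝ) * ∑ b : PBond (F.P K) 0, ρQ ^ 2 * ∑ j, ∑ k, ‖X b j k‖ ^ 2) :=
        mul_le_mul_of_nonneg_left (sum_sum_read_le F n K (fun b => ρQ ^ 2 * ∑ j, ∑ k, ‖X b j k‖ ^ 2) fun b => by positivity) (by positivity)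
    _ = 216 * ρQ ^ 2 * ρ * ∑ b : PBond (F.P K) 0, ∑ j, ∑ k, ‖X b j k‖ ^ 2 := by
        rw [← Finset.mul_sum, show (((F.P K).d : ℝ)) = 3 by exact_mod_cast hd]; ring

end Averaging

/-! ## §6 The averaging penalty under reciprocal weights, in `Q_k`∕`L²` letters -/

section AveragingL2

variable (F : T3Family) {n K : ℕ} (h : n ≤ K) (c₀ cB : ℝ) [Fact (0 < c₀)] [Fact (0 < cB)]

omit [Fact (0 < c₀)] in
/-- **RECIPROCAL BLOCK WEIGHTS PAIR TO THE IDENTITY**: `⟪toL2B(w_c·B), toL2B(w_c⁻¹·B′)⟫ = ⟪toL2B B, toL2B B′⟫` (`w_c ≠ 0` real; the block pairing (3.16)).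
[cite: Balaban1985BackgroundPropagators, (3.16) p.393] -/
theorem inner_toL2B_smul_smul_inv (wc : PBond (F.P n) 0 → ℝ) (hwc : ∀ c, wc c ≠ 0) (B B' : PBond (F.P n) 0 → Matrix (Fin 2) (Fin 2) ℂ) :
    ⟪toL2B F n cB (fun c => wc c • B c), toL2B F n cB (fun c => (wc c)⁻¹ • B' c)⟫_ℂ = ⟪toL2B F n cB B, toL2B F n cB B'⟫_ℂ := by
  rw [inner_toL2B, inner_toL2B]
  congr 1
  refine Finset.sum_congr rfl fun c _ => ?_
  rw [← Complex.coe_smul, ← Complex.coe_smul, Matrix.conjTranspose_smul, Matrix.smul_mul, Matrix.mul_smul, smul_smul, Complex.star_def, Complex.conj_ofReal,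
    ← Complex.ofReal_mul, mul_inv_cancel₀ (hwc c), Complex.ofReal_one, one_smul]

omit [Fact (0 < c₀)] [Fact (0 < cB)] in
/-- `Q_k(toL2(w(b₋)·X)) = toL2B(ĉ ↦ w(x_r ĉ)·(η·(QTwS X ĉ + E ĉ)))` with the relative commutator entry `E` of §5 (✓`Qk_toL2` + ✓`QTwS_smul_eq_ref`).
[cite: Balaban1985BackgroundPropagators, (3.14)–(3.16) p.393] -/
theorem Qk_toL2_smul_eq_ref (U₀ : GaugeField (F.P K) 0 (Matrix.specialUnitaryGroup (Fin 2) ℂ)) (w : Site (F.P K) 0 → ℝ)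
    (xr : PBond (F.P n) 0 → Site (F.P K) 0) (hxr : ∀ c, w (xr c) ≠ 0) (X : PBond (F.P K) 0 → Matrix (Fin 2) (Fin 2) ℂ) :
    Qk F n K h c₀ cB U₀ (toL2 F K c₀ (fun b : PBond (F.P K) 0 => w b.src • X b))
      = toL2B F n cB (fun c => w (xr c) • (((eta F n K : ℝ) : ℂ) • (QTwS F n K h U₀ X c
          + QTwS F n K h U₀ (fun b : PBond (F.P K) 0 => (((w b.src / w (xr c) - 1 : ℝ)) : ℂ) • X b) c))) := by
  rw [Qk_toL2, ← map_smul]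
  congr 1
  funext c
  rw [Pi.smul_apply, QTwS_smul_eq_ref F n K h U₀ w xr hxr X c, smul_comm, Complex.coe_smul]

/-- ★★ **THE AVERAGING PENALTY UNDER RECIPROCAL WEIGHTS** — the (Q) piece of `hVconj`: `RegPr F n K ε₀ U₀`, `10¹⁰L⁶ε₀ ≤ 1`, `10¹²L³ε₀ ≤ 1`; a positive site weight with the read-set
relative oscillations `|w(b₋)∕w(x_r ĉ) − 1|, |w(x_r ĉ)∕w(b₋) − 1| ≤ ρ_Q` (fine bonds sourced in `ĉ₋ ∪ ĉ₊`).  With `κ² := 216·ρ_Q²·(cB∕(c₀ℓ³))`,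
`|re⟪Q_k(toL2(w(b₋)·X)), Q_k(toL2(w(b₋)⁻¹·X))⟫ − ‖Q_k(toL2 X)‖²| ≤ 2·κ·‖Q_k(toL2 X)‖·‖toL2 X‖ + κ²·‖toL2 X‖²` — `η²ℓ² = 1` eats the averaging scale; at the pin `cB = c₀ℓ³`
the letter is `2√216·ρ_Q·‖Q_kX‖‖X‖ + 216ρ_Q²‖X‖²`, K-FREE. [cite: Balaban1985BackgroundPropagators, (3.13)–(3.16) p.393, Thm 3.1 (3.46) p.398; Balaban1985Variational, (44)–(45) p.285] -/
theorem abs_re_inner_Qk_conj_sub_le {ε₀ : ℝ} (hε₀ : 0 < ε₀) (hε : 10 ^ 10 * (F.L : ℝ) ^ 6 * ε₀ ≤ 1) (hε12 : 10 ^ 12 * (F.L : ℝ) ^ 3 * ε₀ ≤ 1)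
    (U₀ : GaugeField (F.P K) 0 (Matrix.specialUnitaryGroup (Fin 2) ℂ)) (hreg : RegPr F n K ε₀ U₀)
    (w : Site (F.P K) 0 → ℝ) (hw : ∀ x, 0 < w x) (xr : PBond (F.P n) 0 → Site (F.P K) 0) {ρQ : ℝ}
    (hρQ : ∀ (c : PBond (F.P n) 0) (b : PBond (F.P K) 0),
      (iterBlockOf (K - n) b.src = (bondShift (sites_eq F n K h) c).src ∨ iterBlockOf (K - n) b.src = (bondShift (sites_eq F n K h) c).tgt) →
      |w b.src / w (xr c) - 1| ≤ ρQ ∧ |w (xr c) / w b.src - 1| ≤ ρQ)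
    (X : PBond (F.P K) 0 → Matrix (Fin 2) (Fin 2) ℂ) :
    |RCLike.re ⟪Qk F n K h c₀ cB U₀ (toL2 F K c₀ (fun b => w b.src • X b)), Qk F n K h c₀ cB U₀ (toL2 F K c₀ (fun b => (w b.src)⁻¹ • X b))⟫_ℂ
        - ‖Qk F n K h c₀ cB U₀ (toL2 F K c₀ X)‖ ^ 2|
      ≤ 2 * Real.sqrt (216 * ρQ ^ 2 * (cB / (c₀ * ((F.L : ℝ) ^ (K - n)) ^ 3))) * ‖Qk F n K h c₀ cB U₀ (toL2 F K c₀ X)‖ * ‖toL2 F K c₀ X‖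
        + 216 * ρQ ^ 2 * (cB / (c₀ * ((F.L : ℝ) ^ (K - n)) ^ 3)) * ‖toL2 F K c₀ X‖ ^ 2 := by
  have hc₀ : 0 < c₀ := Fact.out
  have hcB : 0 < cB := Fact.out
  have hη : 0 < eta F n K := eta_pos F n K
  have hL0 : (0 : ℝ) < F.L := by exact_mod_cast lt_trans zero_lt_one F.hL.2
  have hℓ : (0 : ℝ) < (F.L : ℝ) ^ (K - n) := pow_pos hL0 _
  have hd : (F.P K).d = 3 := T3Family.P_d F K
  have hw0 : ∀ x, w x ≠ 0 := fun x => (hw x).ne'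
  have hxr : ∀ c, w (xr c) ≠ 0 := fun c => hw0 _
  have hxri : ∀ c, (fun x => (w x)⁻¹) (xr c) ≠ 0 := fun c => inv_ne_zero (hw0 _)
  -- the two splits
  set G : PBond (F.P n) 0 → Matrix (Fin 2) (Fin 2) ℂ := QTwS F n K h U₀ X with hG
  set E : PBond (F.P n) 0 → Matrix (Fin 2) (Fin 2) ℂ := fun c =>
    QTwS F n K h U₀ (fun b : PBond (F.P K) 0 => (((w b.src / w (xr c) - 1 : ℝ)) : ℂ) • X b) c with hE
  set E' : PBond (F.P n) 0 → Matrix (Fin 2) (Fin 2) ℂ := fun c =>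
    QTwS F n K h U₀ (fun b : PBond (F.P K) 0 => ((((fun x => (w x)⁻¹) b.src / (fun x => (w x)⁻¹) (xr c) - 1 : ℝ)) : ℂ) • X b) c with hE'
  have h1 : Qk F n K h c₀ cB U₀ (toL2 F K c₀ (fun b => w b.src • X b)) = toL2B F n cB (fun c => w (xr c) • (((eta F n K : ℝ) : ℂ) • (G c + E c))) :=
    Qk_toL2_smul_eq_ref F h c₀ cB U₀ w xr hxr X
  have h2 : Qk F n K h c₀ cB U₀ (toL2 F K c₀ (fun b => (w b.src)⁻¹ • X b)) = toL2B F n cB (fun c => (w (xr c))⁻¹ • (((eta F n K : ℝ) : ℂ) • (G c + E' c))) :=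
    Qk_toL2_smul_eq_ref F h c₀ cB U₀ (fun x => (w x)⁻¹) xr hxri X
  -- the unconjugated vector and the two defects
  set a := Qk F n K h c₀ cB U₀ (toL2 F K c₀ X) with ha
  set k := ((eta F n K : ℝ) : ℂ) • toL2B F n cB E with hk
  set k' := ((eta F n K : ℝ) : ℂ) • toL2B F n cB E' with hk'
  have haG : a = ((eta F n K : ℝ) : ℂ) • toL2B F n cB G := by rw [ha, Qk_toL2]
  have hsum : toL2B F n cB (fun c => ((eta F n K : ℝ) : ℂ) • (G c + E c)) = a + k := by
    rw [haG, hk, ← smul_add, ← map_add, ← map_smul]; rfl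
  have hsum' : toL2B F n cB (fun c => ((eta F n K : ℝ) : ℂ) • (G c + E' c)) = a + k' := by
    rw [haG, hk', ← smul_add, ← map_add, ← map_smul]; rfl
  have hpair : ⟪Qk F n K h c₀ cB U₀ (toL2 F K c₀ (fun b => w b.src • X b)), Qk F n K h c₀ cB U₀ (toL2 F K c₀ (fun b => (w b.src)⁻¹ • X b))⟫_ℂ = ⟪a + k, a + k'⟫_ℂ := by
    rw [h1, h2, inner_toL2B_smul_smul_inv F cB (fun c => w (xr c)) hxr, hsum, hsum']
  -- the defect norms: `‖k‖², ‖k′‖² ≤ κ²‖toL2 X‖²`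
  set κ2 : ℝ := 216 * ρQ ^ 2 * (cB / (c₀ * ((F.L : ℝ) ^ (K - n)) ^ 3)) with hκ2
  have hκ2_0 : 0 ≤ κ2 := by positivity
  have hX : ‖toL2 F K c₀ X‖ ^ 2 = c₀ * ∑ b : PBond (F.P K) 0, ∑ j, ∑ k, ‖X b j k‖ ^ 2 := Prop7LaplaceAFlatLetters.norm_sq_toL2 X
  have hηℓ : eta F n K ^ 2 * (((F.L : ℝ) ^ (K - n)) ^ 2 / ((F.L : ℝ) ^ (K - n)) ^ (F.P K).d) = (((F.L : ℝ) ^ (K - n)) ^ 3)⁻¹ := by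
    rw [hd]
    have e1 := eta_mul_pow_eq_one F (n := n) (K := K)
    field_simp
    nlinarith [e1]
  have hdef : ∀ (Ef : PBond (F.P n) 0 → Matrix (Fin 2) (Fin 2) ℂ),
      (∑ bc : PBond (F.P n) 0, ∑ j, ∑ k, ‖Ef bc j k‖ ^ 2 ≤ 216 * ρQ ^ 2 * (((F.L : ℝ) ^ (K - n)) ^ 2 / ((F.L : ℝ) ^ (K - n)) ^ (F.P K).d) * ∑ b : PBond (F.P K) 0, ∑ j, ∑ k, ‖X b j k‖ ^ 2) →
      ‖((eta F n K : ℝ) : ℂ) • toL2B F n cB Ef‖ ≤ Real.sqrt κ2 * ‖toL2 F K c₀ X‖ := by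
    intro Ef hEf
    have hsq : ‖((eta F n K : ℝ) : ℂ) • toL2B F n cB Ef‖ ^ 2 ≤ (Real.sqrt κ2 * ‖toL2 F K c₀ X‖) ^ 2 := by
      rw [norm_smul, mul_pow, Complex.norm_real, Real.norm_of_nonneg hη.le, norm_toL2B_sq, mul_pow, Real.sq_sqrt hκ2_0, hX, hκ2]
      rw [Finset.sum_congr rfl fun c _ => norm_sq_frobEquiv_symm (Ef c)]
      calc eta F n K ^ 2 * (cB * ∑ c : PBond (F.P n) 0, ∑ j, ∑ k, ‖Ef c j k‖ ^ 2)
          ≤ eta F n K ^ 2 * (cB * (216 * ρQ ^ 2 * (((F.L : ℝ) ^ (K - n)) ^ 2 / ((F.L : ℝ) ^ (K - n)) ^ (F.P K).d) * ∑ b : PBond (F.P K) 0, ∑ j, ∑ k, ‖X b j k‖ ^ 2)) :=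
            mul_le_mul_of_nonneg_left (mul_le_mul_of_nonneg_left hEf hcB.le) (sq_nonneg _)
        _ = 216 * ρQ ^ 2 * (cB / (c₀ * ((F.L : ℝ) ^ (K - n)) ^ 3)) * (c₀ * ∑ b : PBond (F.P K) 0, ∑ j, ∑ k, ‖X b j k‖ ^ 2) := by
            have e2 : cB / (c₀ * ((F.L : ℝ) ^ (K - n)) ^ 3) = cB * (((F.L : ℝ) ^ (K - n)) ^ 3)⁻¹ / c₀ := by
              field_simp
            rw [e2, ← hηℓ]; field_simp
    exact (pow_le_pow_iff_left₀ (norm_nonneg _) (by positivity) two_ne_zero).1 hsq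
  have hkn : ‖k‖ ≤ Real.sqrt κ2 * ‖toL2 F K c₀ X‖ :=
    hdef E (sum_normSq_entries_QTwS_relComm_le F n K h hε₀ hε hε12 U₀ hreg w xr (fun c b hb => (hρQ c b hb).1) X)
  have hk'n : ‖k'‖ ≤ Real.sqrt κ2 * ‖toL2 F K c₀ X‖ := by
    refine hdef E' (sum_normSq_entries_QTwS_relComm_le F n K h hε₀ hε hε12 U₀ hreg (fun x => (w x)⁻¹) xr (fun c b hb => ?_) X)
    simp only [inv_div_inv]
    exact (hρQ c b hb).2
  rw [hpair]
  calc |RCLike.re ⟪a + k, a + k'⟫_ℂ - ‖a‖ ^ 2|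
      ≤ ‖a‖ * (Real.sqrt κ2 * ‖toL2 F K c₀ X‖) + Real.sqrt κ2 * ‖toL2 F K c₀ X‖ * ‖a‖ + Real.sqrt κ2 * ‖toL2 F K c₀ X‖ * (Real.sqrt κ2 * ‖toL2 F K c₀ X‖) :=
        abs_re_inner_add_add_sub_sq_le a k k' hkn hk'n
    _ = 2 * Real.sqrt κ2 * ‖a‖ * ‖toL2 F K c₀ X‖ + Real.sqrt κ2 ^ 2 * ‖toL2 F K c₀ X‖ ^ 2 := by ring
    _ = 2 * Real.sqrt κ2 * ‖a‖ * ‖toL2 F K c₀ X‖ + κ2 * ‖toL2 F K c₀ X‖ ^ 2 := by rw [Real.sq_sqrt hκ2_0]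

end AveragingL2

end Summit.QuantumFields.YangMills.Theorems.Prop7OneFormAgmonAveraging

end
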